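import Summits.RiemannHypothesis.RiemannHypothesis.Theorems.PfPersistenceDialRigidity
import HarnessLib

/-!
# PF-persistence cell — THE PRICE OF THE UN-SERVED REGIME: how small a certificate's level gap must be at rung `m`

Framing (page 1): mechanism/rigidity campaign; no RH claims.  Every `theorem` below is PROVED (kernel-checked,
RH-free, weight-free); nothing asserts a premiss for `ζ` at any window, and no NUMBER for `ζ` is asserted here.

The dial-line rigidity schema (`PfPersistenceDialRigidity`, bc79e5bac59c) pins the `p`-dial line to `K = 1` from
even/odd CERTIFICATES of every width along a family of windows; its honest regime for `ζ` is `a → ∞` at the fixed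
prime, where `p` sits on rung `m = ⌈a/log p⌉₊ → ∞` of the complete near-lag ladder (`PfPersistenceNearLagLadder`,
186f1e2d346c; odd ceiling `c_m = cos(π/(m+1))`).  This file types the NECESSARY SIDE of that regime:
* §1 `|A⁻_v(y)| ≤ ‖v‖²` for every odd test vector and every lag `0 ≤ y ≤ L` (the odd twin of the landed even bound
  `abs_autocorr_le`): a certificate's correlation floor `τ` (odd) or anti-correlation `σ` (even) never exceeds `1`.
* §2 the rung gap `1 − cos(π/(m+1)) ≤ π²/(2(m+1)²)`.
* §3 THE ODD PRICE: an odd certificate of width `δ` at rung `m` (`ℓ' − ε₁⁻ < 2δ·w_p·(τ − c_m − 2φN)`) forces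
  `ℓ' − ε₁⁻ < δ·w_p·π²/(m+1)²`, and in the rung-free form (`m = ⌈a/log p⌉₊`, `0 < log p`, `0 < w p`)
  `ℓ' − ε₁⁻ < δ·w_p·(π·log p/a)²` — level gaps must beat `a⁻²`; and THE FLOOR PRICE: an odd certificate at rung `m`
  exists only if `2φN < π²/(2(m+1)²)`, i.e. for a FIXED floor `φ > 0` and block size `N` no odd certificate exists
  beyond rung `m + 1 ≥ π/(2√(φN))` — upper rigidity through a floored reader is a RAW-reader (`φ → 0`) phenomenon.
* §4 THE EVEN PRICE: an even certificate of width `δ` forces only `ℓ − ε₁⁺ < 2δ·w_p` — NO rung dependence: the two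
  jaws of the pincer are ASYMMETRIC in the un-served regime (PROVED; the DATA of record agrees in direction:
  `μ_even ≪ μ_odd` at every served window, riders of row C6-AUTOCORR-SPLIT).
Nothing here is a statement about RH; whether `ζ`'s level gaps beat these prices along `a → ∞` is OPEN (DATA pending).
-/

set_option linter.dupNamespace false
set_option linter.style.longLine false

open Real Finset Matrix Set MeasureTheory

noncomputable section

namespace Summit.RiemannHypothesis.RiemannHypothesis.Theorems.PfPersistence

/-! ## §1 The odd autocorrelation never exceeds the norm -/

/-- **PROVED — `|A⁻_v(y)| ≤ ‖v‖²`** for every odd coefficient vector `v` and every lag `0 ≤ y ≤ L` (Cauchy–Schwarz in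
the AM–GM form on the overlap, then monotonicity of `∫ θ²` in the interval; odd twin of `abs_autocorr_le`). [folklore] -/
theorem abs_oddAutocorr_le {L : ℝ} (hL : 0 < L) {N : ℕ} (v : Fin N → ℝ) {y : ℝ} (hy0 : 0 ≤ y) (hyL : y ≤ L) :
    |oddAutocorr L v y| ≤ v ⬝ᵥ v := by
  set θ : ℝ → ℝ := fun x => profileOdd L v x with hθ
  have hθc : Continuous θ := continuous_profileOdd L v
  have hab : -(L / 2) ≤ L / 2 - y := by linarith
  have hsq : v ⬝ᵥ v = ∫ x in (-(L / 2))..(L / 2), θ x ^ 2 := (integral_profileOdd_sq hL v).symm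
  have h1 : |oddAutocorr L v y| ≤ ∫ x in (-(L / 2))..(L / 2 - y), |θ x * θ (x + y)| :=
    intervalIntegral.abs_integral_le_integral_abs hab
  have h2 : ∫ x in (-(L / 2))..(L / 2 - y), |θ x * θ (x + y)|
      ≤ ∫ x in (-(L / 2))..(L / 2 - y), ((1 / 2) * θ x ^ 2 + (1 / 2) * θ (x + y) ^ 2) := by
    refine intervalIntegral.integral_mono_on hab (Continuous.intervalIntegrable (by fun_prop) _ _)
      (Continuous.intervalIntegrable (by fun_prop) _ _) fun x _ => ?_
    exact abs_le.2 ⟨by nlinarith [sq_nonneg (θ x + θ (x + y))], by nlinarith [sq_nonneg (θ x - θ (x + y))]⟩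
  have h3 : ∫ x in (-(L / 2))..(L / 2 - y), ((1 / 2) * θ x ^ 2 + (1 / 2) * θ (x + y) ^ 2)
      = (1 / 2) * (∫ x in (-(L / 2))..(L / 2 - y), θ x ^ 2)
        + (1 / 2) * (∫ x in (-(L / 2) + y)..(L / 2), θ x ^ 2) := by
    rw [intervalIntegral.integral_add (Continuous.intervalIntegrable (by fun_prop) _ _)
      (Continuous.intervalIntegrable (by fun_prop) _ _), intervalIntegral.integral_const_mul,
      intervalIntegral.integral_const_mul,
      intervalIntegral.integral_comp_add_right (fun x => θ x ^ 2) y, sub_add_cancel]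
  have hnn : 0 ≤ᵐ[volume.restrict (Set.Ioc (-(L / 2)) (L / 2))] fun x => θ x ^ 2 :=
    Filter.Eventually.of_forall fun x => by simp only [Pi.zero_apply]; positivity
  have hfi : IntervalIntegrable (fun x => θ x ^ 2) volume (-(L / 2)) (L / 2) :=
    Continuous.intervalIntegrable (by fun_prop) _ _
  have h4 : ∫ x in (-(L / 2))..(L / 2 - y), θ x ^ 2 ≤ ∫ x in (-(L / 2))..(L / 2), θ x ^ 2 :=
    intervalIntegral.integral_mono_interval le_rfl hab (by linarith) hnn hfi
  have h5 : ∫ x in (-(L / 2) + y)..(L / 2), θ x ^ 2 ≤ ∫ x in (-(L / 2))..(L / 2), θ x ^ 2 :=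
    intervalIntegral.integral_mono_interval (by linarith) (by linarith) le_rfl hnn hfi
  calc |oddAutocorr L v y| ≤ _ := h1
    _ ≤ _ := h2
    _ = _ := h3
    _ ≤ (1 / 2) * (∫ x in (-(L / 2))..(L / 2), θ x ^ 2) + (1 / 2) * (∫ x in (-(L / 2))..(L / 2), θ x ^ 2) := by
        gcongr
    _ = v ⬝ᵥ v := by rw [hsq]; ring

/-- **PROVED — a certificate's correlation floor is at most `1`:** `τ‖v‖² ≤ A⁻_v(y)`, `v ≠ 0`, `0 ≤ y ≤ L` ⇒ `τ ≤ 1`.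
[folklore] -/
theorem tau_le_one_of_floor {L : ℝ} (hL : 0 < L) {N : ℕ} {v : Fin N → ℝ} (hv : v ≠ 0) {y : ℝ} (hy0 : 0 ≤ y)
    (hyL : y ≤ L) {τ : ℝ} (hτ : τ * (v ⬝ᵥ v) ≤ oddAutocorr L v y) : τ ≤ 1 := by
  have hvv : 0 < v ⬝ᵥ v :=
    lt_of_le_of_ne (dotProduct_self_nonneg_real v) fun h => hv (dotProduct_self_eq_zero.1 h.symm)
  have h := (abs_le.1 (abs_oddAutocorr_le hL v hy0 hyL)).2
  nlinarith

/-- **PROVED — an even certificate's anti-correlation is at most `1`:** `A_v(y) ≤ -σ‖v‖²`, `v ≠ 0`, `0 ≤ y ≤ L` ⇒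
`σ ≤ 1`. [folklore] -/
theorem sigma_le_one_of_anticorr {L : ℝ} (hL : 0 < L) {N : ℕ} {v : Fin (N + 1) → ℝ} (hv : v ≠ 0) {y : ℝ}
    (hy0 : 0 ≤ y) (hyL : y ≤ L) {σ : ℝ} (hσ : autocorr L v y ≤ -σ * (v ⬝ᵥ v)) : σ ≤ 1 := by
  have hvv : 0 < v ⬝ᵥ v :=
    lt_of_le_of_ne (dotProduct_self_nonneg_real v) fun h => hv (dotProduct_self_eq_zero.1 h.symm)
  have h := (abs_le.1 (abs_autocorr_le hL v hy0 hyL)).1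
  nlinarith

/-! ## §2 The rung gap -/

/-- **PROVED — THE RUNG GAP:** `1 − cos(π/(m+1)) ≤ π²/(2(m+1)²)`. [folklore] -/
theorem one_sub_cos_rung_le (m : ℕ) :
    1 - Real.cos (π / ((m:ℝ) + 1)) ≤ π ^ 2 / (2 * ((m:ℝ) + 1) ^ 2) := by
  have h := Real.one_sub_sq_div_two_le_cos (x := π / ((m:ℝ) + 1))
  have e : (π / ((m:ℝ) + 1)) ^ 2 / 2 = π ^ 2 / (2 * ((m:ℝ) + 1) ^ 2) := by
    have : ((m:ℝ) + 1) ≠ 0 := by positivity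
    field_simp
  linarith [h, e]

/-- **PROVED — the rung-free gap in terms of the dilation:** with `m = ⌈a/log p⌉₊` and `0 < log p`,
`π²/(m+1)² < (π·log p/a)²`. [folklore] -/
theorem rung_gap_lt_of_ceil {win : Window} {p : ℕ} (hlog : 0 < Real.log p) :
    π ^ 2 / (((⌈win.a / Real.log p⌉₊ : ℕ) : ℝ) + 1) ^ 2 < (π * Real.log p / win.a) ^ 2 := by
  have ha := win.ha
  have hm : win.a / Real.log p ≤ ((⌈win.a / Real.log p⌉₊ : ℕ) : ℝ) := Nat.le_ceil _
  have hm1 : win.a / Real.log p < ((⌈win.a / Real.log p⌉₊ : ℕ) : ℝ) + 1 := by linarith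
  have hpos : 0 < win.a / Real.log p := div_pos ha hlog
  have hsq : (win.a / Real.log p) ^ 2 < (((⌈win.a / Real.log p⌉₊ : ℕ) : ℝ) + 1) ^ 2 := by
    apply sq_lt_sq' <;> nlinarith
  have e : (π * Real.log p / win.a) ^ 2 = π ^ 2 / (win.a / Real.log p) ^ 2 := by
    field_simp
  rw [e]
  exact div_lt_div_of_pos_left (by positivity) (by positivity) hsq

/-! ## §3 The odd price at rung `m` -/

/-- **PROVED — THE ODD PRICE AT RUNG `m`.** An odd certificate of width `δ > 0` at a window reaching `p`
(`0 ≤ w p`, `0 ≤ φ`; correlation floor `τ‖v‖² ≤ A⁻_v(log p)`, certificate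
`ℓ' − ε₁⁻(w;win) < 2δ·w_p·(τ − cos(π/(m+1)) − 2φN)`) forces `ℓ' − ε₁⁻ < δ·w_p·π²/(m+1)²`: the admissible level gap
shrinks like `(m+1)⁻²` down the ladder. [folklore] -/
theorem oddCertificate_gap_lt {win : Window} {p : ℕ} (hp : p ∈ primeRange (2 * win.a)) {w : Weights}
    (hw : 0 ≤ w p) {φ : ℝ} (hφ : 0 ≤ φ) {m : ℕ} {δ : ℝ} (hδ : 0 < δ) {v : Fin win.N → ℝ} (hv : v ≠ 0) {ℓ τ : ℝ}
    (hτ : τ * (v ⬝ᵥ v) ≤ oddAutocorr (2 * win.a) v (Real.log p))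
    (hcert : ℓ - bottomRayleigh (oddBlock w win) < 2 * δ * w p * (τ - Real.cos (π / ((m:ℝ) + 1)) - 2 * φ * win.N)) :
    ℓ - bottomRayleigh (oddBlock w win) < δ * w p * (π ^ 2 / ((m:ℝ) + 1) ^ 2) := by
  have hL : 0 < 2 * win.a := by linarith [win.ha]
  have hτ1 : τ ≤ 1 :=
    tau_le_one_of_floor hL hv (Real.log_natCast_nonneg p) (log_le_of_mem_primeRange hL.le hp) hτ
  have hgap := one_sub_cos_rung_le m
  have hN : (0:ℝ) ≤ 2 * φ * win.N := by positivity
  have hdw : 0 ≤ δ * w p := mul_nonneg hδ.le hw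
  calc ℓ - bottomRayleigh (oddBlock w win) < 2 * δ * w p * (τ - Real.cos (π / ((m:ℝ) + 1)) - 2 * φ * win.N) := hcert
    _ = 2 * (δ * w p) * (τ - Real.cos (π / ((m:ℝ) + 1)) - 2 * φ * win.N) := by ring
    _ ≤ 2 * (δ * w p) * (π ^ 2 / (2 * ((m:ℝ) + 1) ^ 2)) := by
        apply mul_le_mul_of_nonneg_left _ (by positivity); linarith
    _ = δ * w p * (π ^ 2 / ((m:ℝ) + 1) ^ 2) := by
        have : ((m:ℝ) + 1) ≠ 0 := by positivity
        field_simp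

/-- **PROVED — THE ODD PRICE, RUNG-FREE** (`m = ⌈a/log p⌉₊`, `0 < log p`, `0 < w p`): an odd certificate of width
`δ` at the prime power `p` forces `ℓ' − ε₁⁻ < δ·w_p·(π·log p/a)²` — along `a → ∞` at the fixed prime the admissible
level gaps must beat `a⁻²`. [folklore] -/
theorem oddCertificate_gap_lt_ceil {win : Window} {p : ℕ} (hp : p ∈ primeRange (2 * win.a))
    (hlog : 0 < Real.log p) {w : Weights} (hw : 0 < w p) {φ : ℝ} (hφ : 0 ≤ φ) {δ : ℝ} (hδ : 0 < δ)
    {v : Fin win.N → ℝ} (hv : v ≠ 0) {ℓ τ : ℝ} (hτ : τ * (v ⬝ᵥ v) ≤ oddAutocorr (2 * win.a) v (Real.log p))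
    (hcert : ℓ - bottomRayleigh (oddBlock w win)
      < 2 * δ * w p * (τ - Real.cos (π / (((⌈win.a / Real.log p⌉₊ : ℕ) : ℝ) + 1)) - 2 * φ * win.N)) :
    ℓ - bottomRayleigh (oddBlock w win) < δ * w p * (π * Real.log p / win.a) ^ 2 := by
  have h1 := oddCertificate_gap_lt hp hw.le hφ hδ hv hτ hcert
  have h2 := rung_gap_lt_of_ceil (win := win) hlog
  have h3 : δ * w p * (π ^ 2 / (((⌈win.a / Real.log p⌉₊ : ℕ) : ℝ) + 1) ^ 2) < δ * w p * (π * Real.log p / win.a) ^ 2 :=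
    mul_lt_mul_of_pos_left h2 (mul_pos hδ hw)
  linarith

/-- **PROVED — THE FLOOR PRICE:** an odd certificate at rung `m` with width `δ > 0` and `0 < w p` (so that the
certificate inequality is not vacuous: `0 ≤ ℓ' − ε₁⁻` needs a level bound `ℓ'`) exists only if
`2φN < π²/(2(m+1)²)` — for a FIXED floor `φ > 0` and block size `N` there is NO odd certificate beyond the rung with
`(m+1)² ≥ π²/(4φN)`: upper rigidity through the floored reader is a raw-reader phenomenon. [folklore] -/
theorem floor_lt_of_oddCertificate {win : Window} {p : ℕ} (hp : p ∈ primeRange (2 * win.a)) {w : Weights}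
    (hw : 0 < w p) {φ : ℝ} {m : ℕ} {δ : ℝ} (hδ : 0 < δ) {v : Fin win.N → ℝ} (hv : v ≠ 0) {ℓ τ : ℝ}
    (hℓ : v ⬝ᵥ (oddBlock w win *ᵥ v) ≤ ℓ * (v ⬝ᵥ v)) (hτ : τ * (v ⬝ᵥ v) ≤ oddAutocorr (2 * win.a) v (Real.log p))
    (hcert : ℓ - bottomRayleigh (oddBlock w win) < 2 * δ * w p * (τ - Real.cos (π / ((m:ℝ) + 1)) - 2 * φ * win.N)) :
    2 * φ * win.N < π ^ 2 / (2 * ((m:ℝ) + 1) ^ 2) := by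
  have hL : 0 < 2 * win.a := by linarith [win.ha]
  have hτ1 : τ ≤ 1 :=
    tau_le_one_of_floor hL hv (Real.log_natCast_nonneg p) (log_le_of_mem_primeRange hL.le hp) hτ
  have hgap := one_sub_cos_rung_le m
  have hge : 0 ≤ ℓ - bottomRayleigh (oddBlock w win) := by
    have hvv : 0 < v ⬝ᵥ v :=
      lt_of_le_of_ne (dotProduct_self_nonneg_real v) fun h => hv (dotProduct_self_eq_zero.1 h.symm)
    have h := bottomRayleigh_mul_le_form (oddBlock w win) v
    nlinarith
  have hpos : 0 < τ - Real.cos (π / ((m:ℝ) + 1)) - 2 * φ * win.N := by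
    by_contra h; push Not at h
    have : 2 * δ * w p * (τ - Real.cos (π / ((m:ℝ) + 1)) - 2 * φ * win.N) ≤ 0 :=
      mul_nonpos_iff.2 (Or.inl ⟨by positivity, h⟩)
    linarith
  linarith

/-! ## §4 The even price: no rung dependence -/

/-- **PROVED — THE EVEN PRICE.** An even certificate of width `δ > 0` (`0 ≤ w p`, `0 ≤ φ`; anti-correlation
`A_v(log p) ≤ −σ‖v‖²`, certificate `ℓ − ε₁⁺(w;win) < 2δ·w_p·(σ − 2φ(2N+1))`) forces only `ℓ − ε₁⁺ < 2δ·w_p` —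
independent of the rung: the lower jaw pays no price down the ladder.  With §3 this is the PROVED asymmetry of the
two jaws in the un-served regime. [folklore] -/
theorem evenCertificate_gap_lt {win : Window} {p : ℕ} (hp : p ∈ primeRange (2 * win.a)) {w : Weights}
    (hw : 0 ≤ w p) {φ : ℝ} (hφ : 0 ≤ φ) {δ : ℝ} (hδ : 0 < δ) {v : Fin (win.N + 1) → ℝ} (hv : v ≠ 0) {ℓ σ : ℝ}
    (hσ : autocorr (2 * win.a) v (Real.log p) ≤ -σ * (v ⬝ᵥ v))
    (hcert : ℓ - bottomRayleigh (evenBlock w win) < 2 * δ * w p * (σ - 2 * φ * (2 * win.N + 1))) :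
    ℓ - bottomRayleigh (evenBlock w win) < 2 * δ * w p := by
  have hL : 0 < 2 * win.a := by linarith [win.ha]
  have hσ1 : σ ≤ 1 :=
    sigma_le_one_of_anticorr hL hv (Real.log_natCast_nonneg p) (log_le_of_mem_primeRange hL.le hp) hσ
  have hN : (0:ℝ) ≤ 2 * φ * (2 * win.N + 1) := by positivity
  have hdw : 0 ≤ δ * w p := mul_nonneg hδ.le hw
  calc ℓ - bottomRayleigh (evenBlock w win) < 2 * δ * w p * (σ - 2 * φ * (2 * win.N + 1)) := hcert
    _ = 2 * (δ * w p) * (σ - 2 * φ * (2 * win.N + 1)) := by ring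
    _ ≤ 2 * (δ * w p) * 1 := by apply mul_le_mul_of_nonneg_left _ (by positivity); linarith
    _ = 2 * δ * w p := by ring

end Summit.RiemannHypothesis.RiemannHypothesis.Theorems.PfPersistence

end
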